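import Literature.MathematicalPhysics.QuantumFieldTheory.Balaban1983to89.T3CruxEstimates

/-!
# `Balaban1983to89.T3HeightSandwichSplit` — rung R3, crux K1's estimate SPLIT into two ONE-RUN envelopes of the printed type
# ([Balaban1985UV3] (41) lower / (47) upper: `χ e^{−𝒜−R₋} ≤ ρ ≤ χ e^{−𝒜+R₊}` at the comparison height, one per run) and ONE comparison
# of the two runs' EFFECTIVE ACTIONS modulo a constant — the remainders need only be BOUNDED (summably at height `K − ⌊K/m⌋`), never
# compared

Cell `ym3-torus` (HUMAN RULING D-0037, YM ladder rung R3), seat `ym3-torus-p2` gen 3.  WHAT THIS IS NOT: not d = 4, not a mass gap,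
not Clay, and none of the three inputs is proved: (a)/(b) are the restricted one-run envelopes (41)/(47) of [Balaban1985UV3] at the
height `K − n` resp. `K + 1 − n` (`n = ⌊K/m⌋`), typed on the lane's tower by the cell's p1 seat (`CMP102.SectB.TowerObjects.Ineq41/47
RestrictedAE`, GAP-STATED, fed by the (α) inputs) — here hypotheses about the T³ scheme's CONSTRUCTED densities `heightDensity`; (c) is
the genuinely two-run statement (minimiser two-cutoff stability + kernel convergence, [King1986] Props 3.8/3.9 as abelian template).

WHY THE SPLIT IS RIGHT AT THE COMPARISON HEIGHT.  At the unit scale the (41)/(47) log-radius has a `K`-independent floor (cell record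
UV3-NODE §8 F1 `Rm_unit_floor`), so one-run envelopes cannot give summable radii and the remainders would have to be COMPARED between
runs (IR-NODE §9 (iii), «hardest»).  At height `h⋆ = K − ⌊K/m⌋` the effective coupling is `γL^{-⌊K/m⌋} → 0` and the envelope radius
decays geometrically (UV3-NODE §8 F1: `O(L^{3m}ε₀^{3+κ₀}L^{−κ₀⌊K/4⌋})`), so BOUNDING each run's remainder suffices: the radii add
(`T3UnitScaleTilt.IsTilt.trans` in density form).

* `sandwich_of_envelopes` (pointwise real arithmetic): `e^{−a}C₀e^{−A₀} ≤ H₀ ≤ e^{a}C₀e^{−A₀}`, `e^{−b}C₁e^{−A₁} ≤ H₁ ≤ e^{b}C₁e^{−A₁}`,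
  `|A₁ − A₀ − κ| ≤ r` ⇒ `e^{−(a+b+r)}·c·H₀ ≤ H₁ ≤ e^{a+b+r}·c·H₀` with `c = C₁e^{−κ}/C₀`.
* **`heightSandwichAt_of_envelopes`**: for every `K`, a.e. on the small-field region `{PlaqSmall θ(⌊K/m⌋)}` of the comparison lattice,
  one-run envelopes (a) for run `K` and (b) for run `K+1` with radii `a_K`, `b_K` and ANY positive constants, plus (c) the effective-action
  comparison `|𝒜^{(K+1)} − 𝒜^{(K)} − κ_K| ≤ r_K` there, with `Σ(a_K + b_K + r_K) < ∞` ⇒ `T3CruxEstimates.HeightSandwichAt F γ b₀ p₀ m`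
  (off the small-field region both densities vanish a.e., `heightDensity_histGood_ae_eq_zero`).
-/

noncomputable section

open MeasureTheory Filter Topology
open Literature.MathematicalPhysics.QuantumFieldTheory.Balaban1983to89.T3ContinuumYM3Torus
open Literature.MathematicalPhysics.QuantumFieldTheory.Balaban1983to89.T3UnitLawDensityEML (ℰp measurableE_ℰp)
open Literature.MathematicalPhysics.QuantumFieldTheory.Balaban1983to89.T3UnitScaleTilt
open Literature.MathematicalPhysics.QuantumFieldTheory.Balaban1983to89.T3RestrictedUnitDensity
open Literature.MathematicalPhysics.QuantumFieldTheory.Balaban1983to89.T3TiltDescent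
open Literature.MathematicalPhysics.QuantumFieldTheory.Balaban1983to89.T3CruxEstimates
open Literature.MathematicalPhysics.QuantumFieldTheory.Balaban1983to89.Missing

namespace Literature.MathematicalPhysics.QuantumFieldTheory.Balaban1983to89.T3HeightSandwichSplit

/-! ## §1 Pointwise arithmetic: two envelopes and an action comparison give a two-run sandwich -/

/-- **TWO ONE-RUN ENVELOPES + ONE ACTION COMPARISON ⇒ THE TWO-RUN SANDWICH** (pointwise real arithmetic):
`e^{−a}C₀e^{−A₀} ≤ H₀ ≤ e^{a}C₀e^{−A₀}`, `e^{−b}C₁e^{−A₁} ≤ H₁ ≤ e^{b}C₁e^{−A₁}` (`C₀, C₁ > 0`) and `|A₁ − A₀ − κ| ≤ r` give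
`e^{−(a+b+r)}·c·H₀ ≤ H₁ ≤ e^{a+b+r}·c·H₀` with `c = C₁e^{−κ}/C₀ > 0`.  ([Balaban1985UV3] (41)/(47) are the envelopes, one per run.)
[cite: Balaban1985UV3, (41) p.266 and (47) p.267] -/
theorem sandwich_of_envelopes {H₀ H₁ A₀ A₁ a b r κ C₀ C₁ : ℝ} (hC₀ : 0 < C₀) (hC₁ : 0 < C₁)
    (h₀ : Real.exp (-a) * C₀ * Real.exp (-A₀) ≤ H₀ ∧ H₀ ≤ Real.exp a * C₀ * Real.exp (-A₀))
    (h₁ : Real.exp (-b) * C₁ * Real.exp (-A₁) ≤ H₁ ∧ H₁ ≤ Real.exp b * C₁ * Real.exp (-A₁))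
    (hc : |A₁ - A₀ - κ| ≤ r) :
    Real.exp (-(a + b + r)) * (C₁ * Real.exp (-κ) / C₀) * H₀ ≤ H₁ ∧
      H₁ ≤ Real.exp (a + b + r) * (C₁ * Real.exp (-κ) / C₀) * H₀ := by
  obtain ⟨hc1, hc2⟩ := abs_le.mp hc
  -- `X = C₀ e^{−A₀}`, the run-`K` model density; `H₀ ∈ [e^{−a}X, e^{a}X]` gives `X ≤ e^{a}H₀` and `X ≥ e^{−a}H₀`
  set X : ℝ := C₀ * Real.exp (-A₀) with hX
  have hX0 : 0 < X := mul_pos hC₀ (Real.exp_pos _)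
  have hXup : X ≤ Real.exp a * H₀ := by
    have h := mul_le_mul_of_nonneg_left h₀.1 (Real.exp_pos a).le
    have e : Real.exp a * (Real.exp (-a) * C₀ * Real.exp (-A₀)) = X := by
      rw [hX, ← mul_assoc, ← mul_assoc, ← Real.exp_add, add_neg_cancel, Real.exp_zero, one_mul]
    linarith [e]
  have hXlo : Real.exp (-a) * H₀ ≤ X := by
    have h := mul_le_mul_of_nonneg_left h₀.2 (Real.exp_pos (-a)).le
    have e : Real.exp (-a) * (Real.exp a * C₀ * Real.exp (-A₀)) = X := by
      rw [hX, ← mul_assoc, ← mul_assoc, ← Real.exp_add, neg_add_cancel, Real.exp_zero, one_mul]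
    linarith [e]
  -- the run-`(K+1)` model density `C₁ e^{−A₁}` against `X`: `A₁ ∈ [A₀ + κ − r, A₀ + κ + r]`
  have hM1lo : C₁ * Real.exp (-κ) / C₀ * Real.exp (-r) * X ≤ C₁ * Real.exp (-A₁) := by
    have e : C₁ * Real.exp (-κ) / C₀ * Real.exp (-r) * X = C₁ * Real.exp (-(A₀ + κ + r)) := by
      rw [hX]; field_simp; rw [← Real.exp_add, ← Real.exp_add]; ring_nf
    rw [e]
    exact mul_le_mul_of_nonneg_left (Real.exp_le_exp.mpr (by linarith)) hC₁.le
  have hM1up : C₁ * Real.exp (-A₁) ≤ C₁ * Real.exp (-κ) / C₀ * Real.exp r * X := by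
    have e : C₁ * Real.exp (-κ) / C₀ * Real.exp r * X = C₁ * Real.exp (-(A₀ + κ - r)) := by
      rw [hX]; field_simp; rw [← Real.exp_add, ← Real.exp_add]; ring_nf
    rw [e]
    exact mul_le_mul_of_nonneg_left (Real.exp_le_exp.mpr (by linarith)) hC₁.le
  have hcpos : 0 < C₁ * Real.exp (-κ) / C₀ := div_pos (mul_pos hC₁ (Real.exp_pos _)) hC₀
  constructor
  · -- lower: H₁ ≥ e^{-b} C₁e^{-A₁} ≥ e^{-b} c e^{-r} X ≥ e^{-b} c e^{-r} e^{-a} H₀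
    have h2 : Real.exp (-b) * (C₁ * Real.exp (-κ) / C₀ * Real.exp (-r) * X) ≤ Real.exp (-b) * (C₁ * Real.exp (-A₁)) :=
      mul_le_mul_of_nonneg_left hM1lo (Real.exp_pos _).le
    have h3 : Real.exp (-b) * (C₁ * Real.exp (-κ) / C₀ * Real.exp (-r) * (Real.exp (-a) * H₀)) ≤
        Real.exp (-b) * (C₁ * Real.exp (-κ) / C₀ * Real.exp (-r) * X) :=
      mul_le_mul_of_nonneg_left (mul_le_mul_of_nonneg_left hXlo
        (mul_pos hcpos (Real.exp_pos _)).le) (Real.exp_pos _).le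
    have e : Real.exp (-(a + b + r)) * (C₁ * Real.exp (-κ) / C₀) * H₀ =
        Real.exp (-b) * (C₁ * Real.exp (-κ) / C₀ * Real.exp (-r) * (Real.exp (-a) * H₀)) := by
      have : Real.exp (-(a + b + r)) = Real.exp (-b) * Real.exp (-r) * Real.exp (-a) := by
        rw [← Real.exp_add, ← Real.exp_add]; ring_nf
      rw [this]; ring
    rw [e]
    linarith [h₁.1]
  · -- upper: H₁ ≤ e^{b} C₁e^{-A₁} ≤ e^{b} c e^{r} X ≤ e^{b} c e^{r} e^{a} H₀
    have h2 : Real.exp b * (C₁ * Real.exp (-A₁)) ≤ Real.exp b * (C₁ * Real.exp (-κ) / C₀ * Real.exp r * X) :=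
      mul_le_mul_of_nonneg_left hM1up (Real.exp_pos _).le
    have h3 : Real.exp b * (C₁ * Real.exp (-κ) / C₀ * Real.exp r * X) ≤
        Real.exp b * (C₁ * Real.exp (-κ) / C₀ * Real.exp r * (Real.exp a * H₀)) :=
      mul_le_mul_of_nonneg_left (mul_le_mul_of_nonneg_left hXup
        (mul_pos hcpos (Real.exp_pos _)).le) (Real.exp_pos _).le
    have e : Real.exp (a + b + r) * (C₁ * Real.exp (-κ) / C₀) * H₀ =
        Real.exp b * (C₁ * Real.exp (-κ) / C₀ * Real.exp r * (Real.exp a * H₀)) := by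
      have : Real.exp (a + b + r) = Real.exp b * Real.exp r * Real.exp a := by
        rw [← Real.exp_add, ← Real.exp_add]; ring_nf
      rw [this]; ring
    rw [e]
    have h1' : H₁ ≤ Real.exp b * (C₁ * Real.exp (-A₁)) := by linarith [h₁.2]
    linarith

/-! ## §2 K1's estimate from one-run envelopes at the comparison height and an effective-action comparison -/

/-- **`HeightSandwichAt` ⇐ (a) ∧ (b) ONE-RUN ENVELOPES + (c) ACTION COMPARISON**, for every `K` with `n = ⌊K/m⌋` on the finest
lattice of the `n`-th approximation: (a) a.e. on the small-field region `{PlaqSmall θ(n)}`, `e^{−a_K}C⁰_K e^{−𝒜⁰_K(V)} ≤ ρ^{(K),Gd}_{K−n}(V)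
≤ e^{a_K}C⁰_K e^{−𝒜⁰_K(V)}` ([Balaban1985UV3] (41)/(47) for run `K` at height `K − n`, restricted, ANY positive constant); (b) the same
for run `K+1` at height `K+1−n` with `𝒜¹_K, C¹_K, b_K`; (c) `|𝒜¹_K(V) − 𝒜⁰_K(V) − κ_K| ≤ r_K` on that region (the two runs' effective
actions — background-field action plus fluctuation terms — agree modulo a constant); `Σ(a_K + b_K + r_K) < ∞` (`γ ≥ 0`).  Off the
small-field region both densities vanish a.e. (`heightDensity_histGood_ae_eq_zero`), so nothing is asked there.  The remainders of the
two runs are only BOUNDED (`a_K`, `b_K`), never compared. [cite: Balaban1985UV3, (41) p.266 and (47) p.267] -/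
theorem heightSandwichAt_of_envelopes (F : T3Family) {γ : ℝ} (hγ : 0 ≤ γ) (b₀ p₀ : ℝ) (m : ℕ)
    (𝒜₀ 𝒜₁ : (K : ℕ) → GaugeField (F.P (K / m)) 0 (Matrix.specialUnitaryGroup (Fin 2) ℂ) → ℝ)
    (C₀ C₁ κ a b r : ℕ → ℝ) (hC₀ : ∀ K, 0 < C₀ K) (hC₁ : ∀ K, 0 < C₁ K)
    (ha : ∀ K, 0 ≤ a K) (hb : ∀ K, 0 ≤ b K) (hr : ∀ K, 0 ≤ r K) (hsum : Summable fun K => a K + b K + r K)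
    (henv₀ : ∀ K, ∀ᵐ V ∂fieldMeasure (F.P (K / m)) 0 (Matrix.specialUnitaryGroup (Fin 2) ℂ),
      PlaqSmall (θBal F.L γ b₀ p₀ (K / m)) V →
        Real.exp (-a K) * C₀ K * Real.exp (-𝒜₀ K V) ≤
            heightDensity F γ (Nat.div_le_self K m) (histGood F ℰp (θBal F.L γ b₀ p₀) K (K / m)) V ∧
          heightDensity F γ (Nat.div_le_self K m) (histGood F ℰp (θBal F.L γ b₀ p₀) K (K / m)) V ≤
            Real.exp (a K) * C₀ K * Real.exp (-𝒜₀ K V))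
    (henv₁ : ∀ K, ∀ᵐ V ∂fieldMeasure (F.P (K / m)) 0 (Matrix.specialUnitaryGroup (Fin 2) ℂ),
      PlaqSmall (θBal F.L γ b₀ p₀ (K / m)) V →
        Real.exp (-b K) * C₁ K * Real.exp (-𝒜₁ K V) ≤
            heightDensity F γ ((Nat.div_le_self K m).trans (Nat.le_succ K))
              (histGood F ℰp (θBal F.L γ b₀ p₀) (K + 1) (K / m)) V ∧
          heightDensity F γ ((Nat.div_le_self K m).trans (Nat.le_succ K))
              (histGood F ℰp (θBal F.L γ b₀ p₀) (K + 1) (K / m)) V ≤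
            Real.exp (b K) * C₁ K * Real.exp (-𝒜₁ K V))
    (hcmp : ∀ K, ∀ᵐ V ∂fieldMeasure (F.P (K / m)) 0 (Matrix.specialUnitaryGroup (Fin 2) ℂ),
      PlaqSmall (θBal F.L γ b₀ p₀ (K / m)) V → |𝒜₁ K V - 𝒜₀ K V - κ K| ≤ r K) :
    HeightSandwichAt F γ b₀ p₀ m := by
  refine ⟨fun K => a K + b K + r K, fun K => C₁ K * Real.exp (-κ K) / C₀ K, hsum,
    fun K => add_nonneg (add_nonneg (ha K) (hb K)) (hr K),
    fun K => div_pos (mul_pos (hC₁ K) (Real.exp_pos _)) (hC₀ K), fun K => ?_⟩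
  have hz₀ := heightDensity_histGood_ae_eq_zero F hγ (Nat.div_le_self K m) (θBal F.L γ b₀ p₀)
  have hz₁ := heightDensity_histGood_ae_eq_zero F hγ ((Nat.div_le_self K m).trans (Nat.le_succ K)) (θBal F.L γ b₀ p₀)
  filter_upwards [henv₀ K, henv₁ K, hcmp K, hz₀, hz₁] with V hV₀ hV₁ hVc hVz₀ hVz₁
  by_cases hs : PlaqSmall (θBal F.L γ b₀ p₀ (K / m)) V
  · exact sandwich_of_envelopes (hC₀ K) (hC₁ K) (hV₀ hs) (hV₁ hs) (hVc hs)
  · rw [hVz₀ hs, hVz₁ hs, mul_zero, mul_zero]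
    exact ⟨le_rfl, le_rfl⟩

end Literature.MathematicalPhysics.QuantumFieldTheory.Balaban1983to89.T3HeightSandwichSplit

end
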